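import Literature.Probability.RandomPlanarGeometry.HexSAWBrickWallStripFugacityWidthOneContactFullLDP
import Literature.Probability.RandomPlanarGeometry.HexSAWBrickWallStripFugacityWidthOneContactEntropyBinary
import HarnessLib

/-!
# The large deviation upper bound up to the boundary of the density triangle

Child module of `…ContactFullLDP` (#707: the LDP upper bound on compact subsets of the OPEN density triangle `T`) and `…ContactEntropyBinary`
(#712: the continuous extension of the two-density entropy to the CLOSED triangle `T̄ = {a + a' ≤ ½, 4a + 2a' ≥ 1, 2a + 4a' ≥ 1}`).  With the
extended rate `J̄_{y,z}(a,a') := log μ₁(y,z) − a log y − a' log z − s̄(a,a')` (`s̄` the five-term `negMulLog` form; `J̄ = J̃` on `T`):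
* §1 `J̄` is continuous on `ℝ²` and agrees with `J̃` on `T`; the open segment from a point of `T̄` to the centroid `(2/9, 2/9)` lies in `T`;
* §2 ★★ **NEARLY OPTIMAL INTERIOR TILTS AT BOUNDARY POINTS**: for `x ∈ T̄` and `ε > 0` there is an interior pair `(a,a')` whose log-tilt
  `θ = (log(Y(a,a')/y), log(Y(a',a)/z))` has `J̃(a,a') + ⟨θ, x − (a,a')⟩ ≥ J̄(x) − ε` (supergradient inequality of `…ContactEntropyDuality`
  towards the centroid + continuity of `J̄` along the segment) — the Legendre supremum is approached although no finite tilt realises `x`;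
* §3 ★★★ **LOCAL UPPER BOUND AT EVERY POINT OF THE CLOSED TRIANGLE**: `x ∈ T̄`, `ε > 0` ⇒ for some `r > 0`, eventually
  `P_{N,y,z}((bc/N, tc/N) ∈ B̄(x,r)) ≤ exp(N(−J̄(x) + ε))` (half-plane Chernoff bound at the tilt of §2);
* §4 ★★★ **UPPER BOUND ON COMPACT SUBSETS OF THE CLOSED TRIANGLE**: `K ⊆ T̄` compact nonempty ⇒ a minimiser `m ∈ K` of `J̄` exists and
  eventually `P_N(K) ≤ exp(N(−J̄(m) + ε))` — #707's theorem with `T` replaced by `T̄` (walks glued to a wall, rung-free or zigzag densities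
  included).

## Sources
DemboZeitouni2010 §2.2 Theorem 2.2.30 (Cramér in ℝ^d: the upper bound via half-spaces holds for ALL closed sets, the rate being the Legendre
transform also where it is not attained) and §1.2; JansevanRensburg2000 §3.3 (1st ed., OUP 2000: density functions at the ends of their
interval).  Nothing quoted AS PRINTED; statements are this lineage's.
-/

noncomputable section

open Filter Topology Finset Literature.Probability.LatticeModels Literature.Probability.Percolation SimpleGraph

namespace Literature.Probability.RandomPlanarGeometry.SAW.HexBW

open WidthOneYZ Real

variable {y z : ℝ}

/-! ## §1 The extended rate and the segments to the centroid -/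

/-- On the open triangle the joint rate in density coordinates is `log μ₁(y,z) − a log y − a' log z − s̄(a,a')` with `s̄` the five-term form.
[cite: DemboZeitouni2010, §2.2 (lane plumbing)] -/
theorem jointRate_eosY_eq_ext (hy : 0 < y) (hz : 0 < z) {a a' : ℝ} (h1 : a + a' < 1 / 2) (h2 : 1 < 4 * a + 2 * a')
    (h3 : 1 < 2 * a + 4 * a') :
    jointRate y z (eosY a a') (eosY a' a) = Real.log (stripMuY₂ 1 y z) - a * Real.log y - a' * Real.log z -
      (negMulLog (1 - 2 * a - 2 * a') +
        (negMulLog (4 * a + 2 * a' - 1) + negMulLog (2 * a + 4 * a' - 1) - negMulLog (2 * a) - negMulLog (2 * a')) / 2) := by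
  rw [jointRate_eq_sub_contactEntropy₂ hy hz h1 h2 h3, contactEntropy₂_eq_negMulLog h1 h2 h3]; ring

/-- The extended rate `J̄_{y,z}` is continuous on `ℝ²`. [cite: DemboZeitouni2010, §2.2 (lane plumbing)] -/
theorem continuous_rateExt (y z : ℝ) :
    Continuous (fun p : ℝ × ℝ => Real.log (stripMuY₂ 1 y z) - p.1 * Real.log y - p.2 * Real.log z -
      (negMulLog (1 - 2 * p.1 - 2 * p.2) +
        (negMulLog (4 * p.1 + 2 * p.2 - 1) + negMulLog (2 * p.1 + 4 * p.2 - 1) - negMulLog (2 * p.1) - negMulLog (2 * p.2)) / 2)) := by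
  have h := continuous_contactEntropy₂Ext
  have h1 : Continuous (fun p : ℝ × ℝ => Real.log (stripMuY₂ 1 y z) - p.1 * Real.log y - p.2 * Real.log z) := by fun_prop
  exact h1.sub h

/-- The open segment from a point of the closed triangle to the centroid `(2/9, 2/9)` lies in the open triangle.
[cite: DemboZeitouni2010, §2.2 (lane plumbing)] -/
theorem segment_mem_triangle {x₁ x₂ : ℝ} (h1 : x₁ + x₂ ≤ 1 / 2) (h2 : 1 ≤ 4 * x₁ + 2 * x₂) (h3 : 1 ≤ 2 * x₁ + 4 * x₂) {t : ℝ}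
    (ht0 : 0 < t) (ht1 : t ≤ 1) :
    (x₁ + t * (2 / 9 - x₁)) + (x₂ + t * (2 / 9 - x₂)) < 1 / 2 ∧ 1 < 4 * (x₁ + t * (2 / 9 - x₁)) + 2 * (x₂ + t * (2 / 9 - x₂)) ∧
      1 < 2 * (x₁ + t * (2 / 9 - x₁)) + 4 * (x₂ + t * (2 / 9 - x₂)) := by
  refine ⟨?_, ?_, ?_⟩ <;> nlinarith

/-! ## §2 Nearly optimal interior tilts at every point of the closed triangle -/

/-- The slope bound from the supergradient inequality: for `(a,a')` and `(c,c')` in the open triangle,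
`log(Y(a,a')/y)·(c − a) + log(Y(a',a)/z)·(c' − a') ≤ J̃_{y,z}(c,c') − J̃_{y,z}(a,a')` (the affine minorant of the convex `J̃` at `(a,a')`).
[cite: DemboZeitouni2010, §2.2 (lane statement); JansevanRensburg2000, §3.2 Theorems 3.18–3.19 (1st ed., pp. 51–52)] -/
theorem tilt_inner_le_jointRate_sub (hy : 0 < y) (hz : 0 < z) {a a' c c' : ℝ} (h1 : a + a' < 1 / 2) (h2 : 1 < 4 * a + 2 * a')
    (h3 : 1 < 2 * a + 4 * a') (k1 : c + c' < 1 / 2) (k2 : 1 < 4 * c + 2 * c') (k3 : 1 < 2 * c + 4 * c') :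
    Real.log (eosY a a' / y) * (c - a) + Real.log (eosY a' a / z) * (c' - a') ≤
      jointRate y z (eosY c c') (eosY c' c) - jointRate y z (eosY a a') (eosY a' a) := by
  have hsg := (contactEntropy₂_superGradient h1 h2 h3 k1 k2 k3).1
  obtain ⟨hYa, hZa, -, -, -, -⟩ := contactB_eosY h1 h2 h3
  rw [jointRate_eq_sub_contactEntropy₂ hy hz k1 k2 k3, jointRate_eq_sub_contactEntropy₂ hy hz h1 h2 h3,
    Real.log_div hYa.ne' hy.ne', Real.log_div hZa.ne' hz.ne']
  -- make the transcendental atoms opaque before the linear arithmetic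
  generalize contactEntropy₂ a a' = sA at hsg ⊢
  generalize contactEntropy₂ c c' = sC at hsg ⊢
  generalize Real.log (eosY a a') = lY at hsg ⊢
  generalize Real.log (eosY a' a) = lZ at hsg ⊢
  generalize Real.log (stripMuY₂ 1 y z) = L
  generalize Real.log y = ly
  generalize Real.log z = lz
  nlinarith [hsg]
set_option maxHeartbeats 400000 in
/-- ★★ **NEARLY OPTIMAL INTERIOR TILTS**: for `y, z > 0`, a point `x = (x₁,x₂)` of the CLOSED triangle and `ε > 0` there is a pair `(a,a')` of
the OPEN triangle such that, with `θ = (log(Y(a,a')/y), log(Y(a',a)/z))` its log-tilt,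
`J̃_{y,z}(a,a') + θ₁(x₁ − a) + θ₂(x₂ − a') ≥ J̄_{y,z}(x) − ε`: the affine minorant of the rate at `(a,a')` almost reaches the extended rate at `x`
(`(a,a')` on the segment from `x` to the centroid; the slope towards the centroid is bounded by `tilt_inner_le_jointRate_sub`; continuity of
`J̄` along the segment). [cite: DemboZeitouni2010, §2.2 Theorem 2.2.30 (the Fenchel–Legendre transform at boundary points of the effective domain; lane statement); JansevanRensburg2000, §3.3 (1st ed.)] -/
theorem exists_interior_tilt_ge (hy : 0 < y) (hz : 0 < z) {x₁ x₂ : ℝ} (h1 : x₁ + x₂ ≤ 1 / 2) (h2 : 1 ≤ 4 * x₁ + 2 * x₂)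
    (h3 : 1 ≤ 2 * x₁ + 4 * x₂) {ε : ℝ} (hε : 0 < ε) :
    ∃ a a' : ℝ, a + a' < 1 / 2 ∧ 1 < 4 * a + 2 * a' ∧ 1 < 2 * a + 4 * a' ∧
      Real.log (stripMuY₂ 1 y z) - x₁ * Real.log y - x₂ * Real.log z -
          (negMulLog (1 - 2 * x₁ - 2 * x₂) +
            (negMulLog (4 * x₁ + 2 * x₂ - 1) + negMulLog (2 * x₁ + 4 * x₂ - 1) - negMulLog (2 * x₁) - negMulLog (2 * x₂)) / 2) - ε ≤
        jointRate y z (eosY a a') (eosY a' a) + Real.log (eosY a a' / y) * (x₁ - a) + Real.log (eosY a' a / z) * (x₂ - a') := by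
  -- the extended rate along the segment `t ↦ x + t (c - x)`, `c = (2/9, 2/9)`, is continuous
  have hpc : Continuous (fun t : ℝ => ((x₁ + t * (2 / 9 - x₁), x₂ + t * (2 / 9 - x₂)) : ℝ × ℝ)) := by fun_prop
  have hg := (continuous_rateExt y z).comp hpc
  have hε2 : 0 < ε / 2 := by linarith
  have hev := Metric.tendsto_nhds.1 (hg.tendsto 0) (ε / 2) hε2
  obtain ⟨δ, hδ0, hδ⟩ := Metric.eventually_nhds_iff.1 hev
  -- the centroid
  have c1 : (2 / 9 : ℝ) + 2 / 9 < 1 / 2 := by norm_num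
  have c2 : (1 : ℝ) < 4 * (2 / 9) + 2 * (2 / 9) := by norm_num
  have c3 : (1 : ℝ) < 2 * (2 / 9) + 4 * (2 / 9) := by norm_num
  obtain ⟨hYc, hZc, -, -, -, -⟩ := contactB_eosY c1 c2 c3
  obtain ⟨M, hM⟩ : ∃ M : ℝ, M = jointRate y z (eosY (2 / 9) (2 / 9)) (eosY (2 / 9) (2 / 9)) := ⟨_, rfl⟩
  have hM0 : 0 ≤ M := by rw [hM]; exact jointRate_nonneg_all hy hz hYc hZc
  -- the parameter `t`
  obtain ⟨t, ht⟩ : ∃ t : ℝ, t = min (1 / 2) (min (δ / 2) (ε / (4 * (M + 1)))) := ⟨_, rfl⟩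
  have ht0 : 0 < t := by rw [ht]; exact lt_min (by norm_num) (lt_min (by linarith) (by positivity))
  have ht1 : t ≤ 1 / 2 := by rw [ht]; exact min_le_left _ _
  have htδ : t < δ := by
    have : t ≤ δ / 2 := by rw [ht]; exact (min_le_right _ _).trans (min_le_left _ _)
    linarith
  have htε : t ≤ ε / (4 * (M + 1)) := by rw [ht]; exact (min_le_right _ _).trans (min_le_right _ _)
  obtain ⟨k1, k2, k3⟩ := segment_mem_triangle h1 h2 h3 ht0 (by linarith)
  refine ⟨x₁ + t * (2 / 9 - x₁), x₂ + t * (2 / 9 - x₂), k1, k2, k3, ?_⟩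
  obtain ⟨hYa, hZa, -, -, -, -⟩ := contactB_eosY k1 k2 k3
  have hJa0 : 0 ≤ jointRate y z (eosY (x₁ + t * (2 / 9 - x₁)) (x₂ + t * (2 / 9 - x₂)))
      (eosY (x₂ + t * (2 / 9 - x₂)) (x₁ + t * (2 / 9 - x₁))) := jointRate_nonneg_all hy hz hYa hZa
  -- (1) continuity: `J̄(x) − ε/2 ≤ J̃(a,a')`
  have hclose : Real.log (stripMuY₂ 1 y z) - x₁ * Real.log y - x₂ * Real.log z -
      (negMulLog (1 - 2 * x₁ - 2 * x₂) +
        (negMulLog (4 * x₁ + 2 * x₂ - 1) + negMulLog (2 * x₁ + 4 * x₂ - 1) - negMulLog (2 * x₁) - negMulLog (2 * x₂)) / 2) - ε / 2 ≤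
      jointRate y z (eosY (x₁ + t * (2 / 9 - x₁)) (x₂ + t * (2 / 9 - x₂))) (eosY (x₂ + t * (2 / 9 - x₂)) (x₁ + t * (2 / 9 - x₁))) := by
    have hd : dist t 0 < δ := by rw [dist_zero_right, Real.norm_eq_abs, abs_of_pos ht0]; exact htδ
    have h := hδ hd
    rw [Real.dist_eq, Function.comp_apply, Function.comp_apply] at h
    simp only [zero_mul, add_zero] at h
    rw [← jointRate_eosY_eq_ext hy hz k1 k2 k3] at h
    have := (abs_lt.1 h).1
    linarith
  -- (2) the slope towards the centroid
  have hslope := tilt_inner_le_jointRate_sub hy hz k1 k2 k3 c1 c2 c3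
  rw [← hM] at hslope
  -- `x − a = −(t/(1−t))·(c − a)` coordinatewise; multiply the slope bound by `t/(1−t) ≥ 0`
  have h1t : 0 < 1 - t := by linarith
  have hq : 0 ≤ t / (1 - t) := div_nonneg ht0.le h1t.le
  have ex1 : x₁ - (x₁ + t * (2 / 9 - x₁)) = -(t / (1 - t)) * (2 / 9 - (x₁ + t * (2 / 9 - x₁))) := by field_simp; ring
  have ex2 : x₂ - (x₂ + t * (2 / 9 - x₂)) = -(t / (1 - t)) * (2 / 9 - (x₂ + t * (2 / 9 - x₂))) := by field_simp; ring
  have htilt := mul_le_mul_of_nonneg_left hslope hq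
  -- `(t/(1−t))·(M − J̃) ≤ 2t·M ≤ ε/2`
  have q1 : t / (1 - t) ≤ 2 * t := by rw [div_le_iff₀ h1t]; nlinarith
  have q2 : t / (1 - t) * (M - jointRate y z (eosY (x₁ + t * (2 / 9 - x₁)) (x₂ + t * (2 / 9 - x₂)))
      (eosY (x₂ + t * (2 / 9 - x₂)) (x₁ + t * (2 / 9 - x₁)))) ≤ 2 * t * M := by
    have e1 := mul_le_mul_of_nonneg_right q1 hM0
    have e2 : t / (1 - t) * (M - jointRate y z (eosY (x₁ + t * (2 / 9 - x₁)) (x₂ + t * (2 / 9 - x₂)))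
        (eosY (x₂ + t * (2 / 9 - x₂)) (x₁ + t * (2 / 9 - x₁)))) ≤ t / (1 - t) * M :=
      mul_le_mul_of_nonneg_left (by linarith) hq
    linarith
  have q3 : 2 * t * M ≤ ε / 2 := by
    have e1 : 2 * t * M ≤ 2 * (ε / (4 * (M + 1))) * M := by nlinarith
    have e2 : 2 * (ε / (4 * (M + 1))) * M = (ε / 2) * (M / (M + 1)) := by field_simp; ring
    have e3 : M / (M + 1) ≤ 1 := by rw [div_le_one (by linarith)]; linarith
    have e4 : (ε / 2) * (M / (M + 1)) ≤ ε / 2 * 1 := mul_le_mul_of_nonneg_left e3 hε2.le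
    linarith
  rw [ex1, ex2]
  -- opaque atoms, then linear arithmetic
  generalize jointRate y z (eosY (x₁ + t * (2 / 9 - x₁)) (x₂ + t * (2 / 9 - x₂)))
      (eosY (x₂ + t * (2 / 9 - x₂)) (x₁ + t * (2 / 9 - x₁))) = J at hclose htilt q2 ⊢
  generalize Real.log (eosY (x₁ + t * (2 / 9 - x₁)) (x₂ + t * (2 / 9 - x₂)) / y) = θ₁ at htilt ⊢
  generalize Real.log (eosY (x₂ + t * (2 / 9 - x₂)) (x₁ + t * (2 / 9 - x₁)) / z) = θ₂ at htilt ⊢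
  generalize Real.log (stripMuY₂ 1 y z) = L at hclose ⊢
  generalize negMulLog (1 - 2 * x₁ - 2 * x₂) = n1 at hclose ⊢
  generalize negMulLog (4 * x₁ + 2 * x₂ - 1) = n2 at hclose ⊢
  generalize negMulLog (2 * x₁ + 4 * x₂ - 1) = n3 at hclose ⊢
  generalize negMulLog (2 * x₁) = n4 at hclose ⊢
  generalize negMulLog (2 * x₂) = n5 at hclose ⊢
  generalize Real.log y = ly at hclose ⊢
  generalize Real.log z = lz at hclose ⊢
  generalize t / (1 - t) = q at htilt q2 hq ⊢
  linarith [hclose, htilt, q2, q3]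

/-! ## §3 The local upper bound at every point of the closed triangle -/

open Classical in
/-- ★★★ **LOCAL UPPER BOUND AT EVERY POINT OF THE CLOSED TRIANGLE**: for `y, z > 0`, a point `x = (x₁,x₂)` of the CLOSED density triangle
and `ε > 0` there is `r > 0` such that eventually
`P_{N,y,z}((bc/N, tc/N) ∈ B̄(x, r)) ≤ exp(N(−J̄_{y,z}(x) + ε))`, `J̄` the extended rate
(half-plane Chernoff bound `sum_halfPlane_mul_exp_le` at the nearly optimal interior tilt of §2; `B̄` the closed sup-ball).
[cite: DemboZeitouni2010, §2.2 Theorem 2.2.30 (upper bound: every point has a neighbourhood of the right exponential size, also at boundary points of the domain); JansevanRensburg2000, §3.3 (1st ed.; lane statement)] -/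
theorem ldp_local_upper_closed (hy : 0 < y) (hz : 0 < z) {x₁ x₂ : ℝ} (h1 : x₁ + x₂ ≤ 1 / 2) (h2 : 1 ≤ 4 * x₁ + 2 * x₂)
    (h3 : 1 ≤ 2 * x₁ + 4 * x₂) {ε : ℝ} (hε : 0 < ε) :
    ∃ r : ℝ, 0 < r ∧ ∀ᶠ N : ℕ in atTop,
      (∑ q ∈ (stripPairs 1 N).filter (fun q =>
        (((bottomVisits₀ q.1 q.2 N : ℝ) / N, (topVisits₀ 1 q.1 q.2 N : ℝ) / N) : ℝ × ℝ) ∈ Metric.closedBall ((x₁, x₂) : ℝ × ℝ) r),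
          wgt y z N q) / stripZ₂ 1 N y z ≤
        Real.exp ((-(Real.log (stripMuY₂ 1 y z) - x₁ * Real.log y - x₂ * Real.log z -
          (negMulLog (1 - 2 * x₁ - 2 * x₂) +
            (negMulLog (4 * x₁ + 2 * x₂ - 1) + negMulLog (2 * x₁ + 4 * x₂ - 1) - negMulLog (2 * x₁) - negMulLog (2 * x₂)) / 2)) + ε) * N) := by
  have hε3 : 0 < ε / 3 := by linarith
  obtain ⟨a, a', k1, k2, k3, hge⟩ := exists_interior_tilt_ge hy hz h1 h2 h3 hε3
  obtain ⟨hY0, hZ0, hb, hb', -, -⟩ := contactB_eosY k1 k2 k3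
  set Y := eosY a a' with hYd
  set Z := eosY a' a with hZd
  set u := Real.log (Y / y) with hu
  set v := Real.log (Z / z) with hv
  have eY : y * Real.exp (1 * u) = Y := by rw [one_mul, hu, Real.exp_log (div_pos hY0 hy)]; field_simp
  have eZ : z * Real.exp (1 * v) = Z := by rw [one_mul, hv, Real.exp_log (div_pos hZ0 hz)]; field_simp
  -- the radius: the linear functional varies by at most `ε/3` on the ball
  set r := ε / (3 * (|u| + |v| + 1)) with hr
  have hL : 0 < |u| + |v| + 1 := by positivity
  have hr0 : 0 < r := by rw [hr]; positivity
  refine ⟨r, hr0, ?_⟩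
  set c := u * x₁ + v * x₂ - ε / 3 with hc
  have hS := fun N : ℕ => sum_halfPlane_mul_exp_le hy.le hz.le u v (zero_le_one) c N
  simp only [eY, eZ] at hS
  have hch := fraction_le_exp_of_chernoff₂ hy hz hY0 hZ0 (Real.exp_pos (1 * c)) 1 0 _ hS hε3
  filter_upwards [hch, Filter.eventually_gt_atTop 0] with N hN hN0
  have hNr : (0 : ℝ) < N := by exact_mod_cast hN0
  -- the exponent: `c − log(μ₁(Y,Z)/μ₁(y,z)) = J̃(a,a') + ⟨θ, x − (a,a')⟩ − ε/3 ≥ J̄(x) − 2ε/3`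
  have hJ : jointRate y z Y Z = a * u + a' * v - Real.log (stripMuY₂ 1 Y Z / stripMuY₂ 1 y z) := by
    unfold jointRate; rw [hb, hb']
  have hexp : -((1 : ℝ) * Real.log (Real.exp (1 * c)) - Real.log (stripMuY₂ 1 Y Z / stripMuY₂ 1 y z)) + ε / 3 ≤
      -(Real.log (stripMuY₂ 1 y z) - x₁ * Real.log y - x₂ * Real.log z -
          (negMulLog (1 - 2 * x₁ - 2 * x₂) +
            (negMulLog (4 * x₁ + 2 * x₂ - 1) + negMulLog (2 * x₁ + 4 * x₂ - 1) - negMulLog (2 * x₁) - negMulLog (2 * x₂)) / 2)) + ε := by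
    rw [Real.log_exp, one_mul, hc]
    have e : jointRate y z Y Z + u * (x₁ - a) + v * (x₂ - a') = u * x₁ + v * x₂ - Real.log (stripMuY₂ 1 Y Z / stripMuY₂ 1 y z) := by
      rw [hJ]; ring
    -- opaque atoms, then linear arithmetic
    generalize jointRate y z Y Z = Jt at hge e ⊢
    generalize Real.log (stripMuY₂ 1 Y Z / stripMuY₂ 1 y z) = R at e ⊢
    generalize Real.log (stripMuY₂ 1 y z) = L at hge ⊢
    generalize negMulLog (1 - 2 * x₁ - 2 * x₂) = n1 at hge ⊢
    generalize negMulLog (4 * x₁ + 2 * x₂ - 1) = n2 at hge ⊢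
    generalize negMulLog (2 * x₁ + 4 * x₂ - 1) = n3 at hge ⊢
    generalize negMulLog (2 * x₁) = n4 at hge ⊢
    generalize negMulLog (2 * x₂) = n5 at hge ⊢
    generalize Real.log y = ly at hge ⊢
    generalize Real.log z = lz at hge ⊢
    linarith [hge, e]
  refine le_trans ?_ (hN.trans (Real.exp_le_exp.2 (mul_le_mul_of_nonneg_right hexp (Nat.cast_nonneg N))))
  refine div_le_div_of_nonneg_right ?_ (stripZ₂_pos 1 N hy hz).le
  refine Finset.sum_le_sum_of_subset_of_nonneg (fun q hq => ?_) fun q _ _ => wgt_nonneg hy.le hz.le N q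
  rw [Finset.mem_filter] at hq ⊢
  refine ⟨hq.1, ?_⟩
  -- in the ball: `u p₁ + v p₂ ≥ u x₁ + v x₂ − r(|u| + |v|) ≥ c`
  have hball := hq.2
  rw [Metric.mem_closedBall, Prod.dist_eq, Real.dist_eq, Real.dist_eq, max_le_iff] at hball
  obtain ⟨d1, d2⟩ := hball
  have e1 : |u * ((bottomVisits₀ q.1 q.2 N : ℝ) / N - x₁)| ≤ |u| * r := by
    rw [abs_mul]; exact mul_le_mul_of_nonneg_left d1 (abs_nonneg _)
  have e2 : |v * ((topVisits₀ 1 q.1 q.2 N : ℝ) / N - x₂)| ≤ |v| * r := by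
    rw [abs_mul]; exact mul_le_mul_of_nonneg_left d2 (abs_nonneg _)
  have e3 : (|u| + |v|) * r ≤ ε / 3 := by
    rw [hr, show (|u| + |v|) * (ε / (3 * (|u| + |v| + 1))) = (ε / 3) * ((|u| + |v|) / (|u| + |v| + 1)) by field_simp]
    have h1' : (|u| + |v|) / (|u| + |v| + 1) ≤ 1 := by rw [div_le_one hL]; linarith
    have := mul_le_mul_of_nonneg_left h1' hε3.le
    linarith
  have f1 := (abs_le.1 e1).1
  have f2 := (abs_le.1 e2).1
  have k2 : c ≤ u * ((bottomVisits₀ q.1 q.2 N : ℝ) / N) + v * ((topVisits₀ 1 q.1 q.2 N : ℝ) / N) := by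
    rw [hc]
    have g1 : u * ((bottomVisits₀ q.1 q.2 N : ℝ) / N - x₁) = u * ((bottomVisits₀ q.1 q.2 N : ℝ) / N) - u * x₁ := by ring
    have g2 : v * ((topVisits₀ 1 q.1 q.2 N : ℝ) / N - x₂) = v * ((topVisits₀ 1 q.1 q.2 N : ℝ) / N) - v * x₂ := by ring
    have g3 : (|u| + |v|) * r = |u| * r + |v| * r := by ring
    linarith [f1, f2, e3, g1, g2, g3]
  have k3 := mul_le_mul_of_nonneg_right k2 hNr.le
  have e4 : (u * ((bottomVisits₀ q.1 q.2 N : ℝ) / N) + v * ((topVisits₀ 1 q.1 q.2 N : ℝ) / N)) * N =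
      u * (bottomVisits₀ q.1 q.2 N : ℝ) + v * (topVisits₀ 1 q.1 q.2 N : ℝ) := by field_simp
  linarith

/-! ## §4 The upper bound on compact subsets of the closed triangle -/

open Classical in
/-- ★★★ **LDP UPPER BOUND ON COMPACT SUBSETS OF THE CLOSED TRIANGLE**: for `y, z > 0` and a nonempty compact `K` inside the CLOSED
density triangle `T̄` (any shape; points of the adsorbed and repelling edges allowed) there is a minimiser `m ∈ K` of the extended rate `J̄_{y,z}`
on `K`, and for every `ε > 0` eventually `P_{N,y,z}((bc/N, tc/N) ∈ K) ≤ exp(N(−J̄_{y,z}(m) + ε))` — #707's `ldp_upper_compact` with the open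
triangle replaced by the closed one (finite cover of `K` by the balls of §3; the ball count is absorbed in `exp(Nε/2)`).
[cite: DemboZeitouni2010, §2.2 Theorem 2.2.30 (Cramér upper bound for all closed sets) and §1.2 (covering step); JansevanRensburg2000, §3.3 (1st ed.; lane statement)] -/
theorem ldp_upper_compact_closed (hy : 0 < y) (hz : 0 < z) {K : Set (ℝ × ℝ)} (hK : IsCompact K) (hne : K.Nonempty)
    (hKT : K ⊆ {p : ℝ × ℝ | p.1 + p.2 ≤ 1 / 2 ∧ 1 ≤ 4 * p.1 + 2 * p.2 ∧ 1 ≤ 2 * p.1 + 4 * p.2}) :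
    ∃ m ∈ K, IsMinOn (fun p : ℝ × ℝ => Real.log (stripMuY₂ 1 y z) - p.1 * Real.log y - p.2 * Real.log z -
      (negMulLog (1 - 2 * p.1 - 2 * p.2) +
        (negMulLog (4 * p.1 + 2 * p.2 - 1) + negMulLog (2 * p.1 + 4 * p.2 - 1) - negMulLog (2 * p.1) - negMulLog (2 * p.2)) / 2)) K m ∧
      ∀ {ε : ℝ}, 0 < ε → ∀ᶠ N : ℕ in atTop,
        (∑ q ∈ (stripPairs 1 N).filter (fun q =>
          (((bottomVisits₀ q.1 q.2 N : ℝ) / N, (topVisits₀ 1 q.1 q.2 N : ℝ) / N) : ℝ × ℝ) ∈ K), wgt y z N q) / stripZ₂ 1 N y z ≤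
        Real.exp ((-(Real.log (stripMuY₂ 1 y z) - m.1 * Real.log y - m.2 * Real.log z -
          (negMulLog (1 - 2 * m.1 - 2 * m.2) +
            (negMulLog (4 * m.1 + 2 * m.2 - 1) + negMulLog (2 * m.1 + 4 * m.2 - 1) - negMulLog (2 * m.1) - negMulLog (2 * m.2)) / 2)) + ε) * N) := by
  set J : ℝ × ℝ → ℝ := fun p => Real.log (stripMuY₂ 1 y z) - p.1 * Real.log y - p.2 * Real.log z -
      (negMulLog (1 - 2 * p.1 - 2 * p.2) +
        (negMulLog (4 * p.1 + 2 * p.2 - 1) + negMulLog (2 * p.1 + 4 * p.2 - 1) - negMulLog (2 * p.1) - negMulLog (2 * p.2)) / 2)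
    with hJdef
  have hJc : Continuous J := continuous_rateExt y z
  obtain ⟨m, hm, hmin⟩ := hK.exists_isMinOn hne hJc.continuousOn
  refine ⟨m, hm, hmin, fun {ε} hε => ?_⟩
  have hε2 : 0 < ε / 2 := by linarith
  -- radii from §3 (with `ε/2`)
  have hrad : ∀ x : ℝ × ℝ, ∃ r : ℝ, 0 < r ∧ (x ∈ K → ∀ᶠ N : ℕ in atTop,
      (∑ q ∈ (stripPairs 1 N).filter (fun q =>
        (((bottomVisits₀ q.1 q.2 N : ℝ) / N, (topVisits₀ 1 q.1 q.2 N : ℝ) / N) : ℝ × ℝ) ∈ Metric.closedBall x r),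
          wgt y z N q) / stripZ₂ 1 N y z ≤ Real.exp ((-(J x) + ε / 2) * N)) := by
    intro x
    by_cases hx : x ∈ K
    · obtain ⟨t1, t2, t3⟩ := hKT hx
      obtain ⟨r, hr0, hr⟩ := ldp_local_upper_closed hy hz t1 t2 t3 hε2
      exact ⟨r, hr0, fun _ => hr⟩
    · exact ⟨1, one_pos, fun h => absurd h hx⟩
  choose r hr0 hrK using hrad
  obtain ⟨t, htK, hcover⟩ :=
    hK.elim_nhds_subcover (fun x => Metric.ball x (r x)) (fun x _ => Metric.ball_mem_nhds x (hr0 x))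
  have hball : ∀ x ∈ t, ∀ᶠ N : ℕ in atTop,
      (∑ q ∈ (stripPairs 1 N).filter (fun q =>
        (((bottomVisits₀ q.1 q.2 N : ℝ) / N, (topVisits₀ 1 q.1 q.2 N : ℝ) / N) : ℝ × ℝ) ∈ Metric.closedBall x (r x)), wgt y z N q) /
        stripZ₂ 1 N y z ≤ Real.exp ((-(J m) + ε / 2) * N) := by
    intro x hx
    have hxK : x ∈ K := htK x hx
    have h2 : J m ≤ J x := (isMinOn_iff.1 hmin) x hxK
    filter_upwards [hrK x hxK] with N hN
    refine hN.trans (Real.exp_le_exp.2 (mul_le_mul_of_nonneg_right ?_ (Nat.cast_nonneg N)))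
    linarith
  have hcard : ∀ᶠ N : ℕ in atTop, (t.card : ℝ) ≤ Real.exp (ε / 2 * N) := by
    have h : Tendsto (fun N : ℕ => Real.exp (ε / 2 * (N : ℝ))) atTop atTop :=
      Real.tendsto_exp_atTop.comp (tendsto_natCast_atTop_atTop.const_mul_atTop hε2)
    exact h.eventually_ge_atTop _
  filter_upwards [(Finset.eventually_all t).2 hball, hcard] with N hN hc
  have hnum : (∑ q ∈ (stripPairs 1 N).filter (fun q =>
      (((bottomVisits₀ q.1 q.2 N : ℝ) / N, (topVisits₀ 1 q.1 q.2 N : ℝ) / N) : ℝ × ℝ) ∈ K), wgt y z N q) ≤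
      ∑ x ∈ t, ∑ q ∈ (stripPairs 1 N).filter (fun q =>
        (((bottomVisits₀ q.1 q.2 N : ℝ) / N, (topVisits₀ 1 q.1 q.2 N : ℝ) / N) : ℝ × ℝ) ∈ Metric.closedBall x (r x)), wgt y z N q := by
    rw [Finset.sum_filter]
    simp_rw [Finset.sum_filter]
    rw [Finset.sum_comm]
    refine Finset.sum_le_sum fun q _ => ?_
    have hnn : ∀ x' ∈ t, (0 : ℝ) ≤ (if (((bottomVisits₀ q.1 q.2 N : ℝ) / N, (topVisits₀ 1 q.1 q.2 N : ℝ) / N) : ℝ × ℝ) ∈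
        Metric.closedBall x' (r x') then wgt y z N q else 0) := by
      intro x' _
      split_ifs
      · exact wgt_nonneg hy.le hz.le N q
      · exact le_rfl
    split_ifs with hqK
    · obtain ⟨x, hxt, hxball⟩ := Set.mem_iUnion₂.1 (hcover hqK)
      have hxcl : (((bottomVisits₀ q.1 q.2 N : ℝ) / N, (topVisits₀ 1 q.1 q.2 N : ℝ) / N) : ℝ × ℝ) ∈ Metric.closedBall x (r x) :=
        Metric.ball_subset_closedBall hxball
      have hs := Finset.single_le_sum hnn hxt
      rw [if_pos hxcl] at hs
      exact hs
    · exact Finset.sum_nonneg hnn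
  have hZ := stripZ₂_pos 1 N hy hz
  calc (∑ q ∈ (stripPairs 1 N).filter (fun q =>
          (((bottomVisits₀ q.1 q.2 N : ℝ) / N, (topVisits₀ 1 q.1 q.2 N : ℝ) / N) : ℝ × ℝ) ∈ K), wgt y z N q) / stripZ₂ 1 N y z
      ≤ (∑ x ∈ t, ∑ q ∈ (stripPairs 1 N).filter (fun q =>
          (((bottomVisits₀ q.1 q.2 N : ℝ) / N, (topVisits₀ 1 q.1 q.2 N : ℝ) / N) : ℝ × ℝ) ∈ Metric.closedBall x (r x)), wgt y z N q) /
          stripZ₂ 1 N y z := div_le_div_of_nonneg_right hnum hZ.le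
    _ = ∑ x ∈ t, (∑ q ∈ (stripPairs 1 N).filter (fun q =>
          (((bottomVisits₀ q.1 q.2 N : ℝ) / N, (topVisits₀ 1 q.1 q.2 N : ℝ) / N) : ℝ × ℝ) ∈ Metric.closedBall x (r x)), wgt y z N q) /
          stripZ₂ 1 N y z := Finset.sum_div _ _ _
    _ ≤ ∑ x ∈ t, Real.exp ((-(J m) + ε / 2) * N) := Finset.sum_le_sum fun x hx => hN x hx
    _ = (t.card : ℝ) * Real.exp ((-(J m) + ε / 2) * N) := by rw [Finset.sum_const, nsmul_eq_mul]
    _ ≤ Real.exp (ε / 2 * N) * Real.exp ((-(J m) + ε / 2) * N) :=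
        mul_le_mul_of_nonneg_right hc (Real.exp_pos _).le
    _ = Real.exp ((-(J m) + ε) * N) := by rw [← Real.exp_add]; ring_nf

end Literature.Probability.RandomPlanarGeometry.SAW.HexBW
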